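import Literature.MathematicalPhysics.QuantumLattice.EmeryThreeBandThermalPressure
import Literature.MathematicalPhysics.QuantumLattice.EmeryThreeBandBlock2x2RayleighCap
import Literature.MathematicalPhysics.QuantumLattice.PeierlsOrthonormalFamily
import HarnessLib

/-!
# The three-band `T > 0` FLOOR from CLUSTER VECTORS (device door): orthonormal trial vectors of the open `Cu₄O₈` block, ranked as
# `hubbardOpenBoxGP 1 12`, give `¼ · log Σ_i e^{−β e_i} ≤ emeryCellPressure β θ` at every `θ` (Peierls + the exact cluster-Gibbs floor)

Topic `Literature/MathematicalPhysics/QuantumLattice` (family `hubbard`; crew hubbard-fast S2 «multi-band × T > 0», seat hubbard-box-p1). The floor door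
of `EmeryThreeBandThermalPressure` (`log Re Tr_S e^{−βH^θ_S} ≤ ab · emeryCellPressure β θ`, `S = Cu_{ab}O_{2ab}`) wants a certified LOWER bound on
a cluster log-partition function. Full diagonalisation of the 12-site `Cu₄O₈` block (Fock dimension `2²⁴`) is out of reach, but Peierls'
inequality for an orthonormal family (`PeierlsOrthonormalFamily`: `Σ_i e^{−β Re⟨φ_i, Hφ_i⟩} ≤ Re Tr e^{−βH}`) turns ANY finite set of orthonormal
cluster vectors with certified Rayleigh quotients — the output of the kernel cluster device of hubbard-box-p2 (coded rational vectors on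
`Fock (Orb (Fin 1 ×ₗ Fin 12))`, exact quadratic forms of `hubbardOpenBoxGP 1 12 τ υ ν`) — into a certified floor. This file is the dictionary:

* §1 **`relabel_block_emeryInteraction`**: relabelled by rank (`cu4o8SiteEquiv` of `EmeryThreeBandBlock2x2RayleighCap`), the block Hamiltonian
  `H^θ_S`, `S = emeryPhysSites block2x2`, IS `hubbardOpenBoxGP 1 12 (blockTau θ) (blockUps θ) (blockNu θ)` with the `θ`-combined tables
  `blockTau θ = Σ_a θ_a · cu4o8Tau a` etc.; hence `Z_β(H^θ_S) = Z_β(hubbardOpenBoxGP 1 12 (blockTau θ) …)` (`partitionFn_block_eq`).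
* §2 **THE DEVICE FLOOR** (`le_emeryCellPressure_of_rayleighFamily`): for `β ≥ 0`, a nonempty orthonormal family `(φ_i)` of cluster vectors and
  certified bounds `Re⟨φ_i, hubbardOpenBoxGP 1 12 (blockTau θ) (blockUps θ) (blockNu θ) φ_i⟩ ≤ e_i`:
  **`¼ · log Σ_i e^{−β e_i} ≤ emeryCellPressure β θ`**; exact-Rayleigh form `log_sum_exp_rayleigh_le_emeryCellPressure`; one vector:
  `−β e/4 ≤ emeryCellPressure β θ` (`neg_mul_le_emeryCellPressure_of_rayleigh` — the `T = 0` trial energy caps the free energy per cell).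

Everything is PROVED (0 sorry); definitions with bodies: `blockTau`, `blockUps`, `blockNu` (the `θ`-combined `0/1` tables). HONEST SCOPE: a floor
only (free-energy CAP per `CuO₂` unit); its quality is that of the trial family (Lanczos/Ritz vectors of the low sectors make it tight up to
`e^{−β·gap}`); the matching pressure CAP needs an upper bound on the boosted cluster's `log Tr e^{−βH^w}` (`emeryCellPressure_le_log_partitionFn_generalPair`).

## Tree / Mathlib search

REUSED: `cu4o8SiteEquiv`, `cu4o8Tau/Ups/Nu`, `relabel_block_emeryAtoms`, `block2x2` (`EmeryThreeBandBlock2x2RayleighCap`); `localHamiltonian_emeryInteraction`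
(`EmeryThreeBandClusterTrialCap`); `log_partitionFn_physCluster_le`, `emeryCellPressure` (`EmeryThreeBandThermalPressure`);
`Matrix.IsHermitian.sum_exp_neg_mul_rayleigh_le_partitionFn` (`PeierlsOrthonormalFamily`); `partitionFn_relabel`, `isHermitian_relabel` (`FermionRelabelling`,
`FermionPartialTrace`); `hubbardOpenBoxGP_eq_generalPairHamiltonian`, `generalPairHamiltonian_linear` (`EmeryThreeBandGeneralPairForm`, `HubbardOpenBoxGeneralPairCluster`).
`lean search 'rayleigh.*emery|emeryCellPressure.*exp'` (2026-08-28): nothing.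

## References

* R. Peierls, Phys. Rev. 54 (1938) 918; D. Ruelle, *Statistical Mechanics* (1969), §2.5–2.6. [cite: Ruelle1969, §2.5–2.6]
* R. B. Israel, *Convexity in the Theory of Lattice Gases* (1979), Lemma II.3.1. [cite: Israel1979, Lemma II.3.1]
* E. Pavarini et al., Phys. Rev. Lett. 87 (2001) 047003, eq. (1). [cite: PavariniEtAl2001, eq. (1)]
-/

noncomputable section

open scoped ComplexOrder BigOperators
open Finset

namespace Literature.MathematicalPhysics.QuantumLattice

open Matrix HubbardWave0 Literature.Probability.LatticeModels ThermodynamicLimit ClusterLowerBound InfVolFermionState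

/-! ### §1. The block Hamiltonian at `θ` as ONE general-pair cluster -/

/-- The `θ`-combined bond table of the `Cu₄O₈` block: `Σ_a θ_a · cu4o8Tau a`. [cite: PavariniEtAl2001, eq. (1)] -/
def blockTau (θ : Fin 14 → ℝ) (i j : Fin 1 ×ₗ Fin 12) : ℝ := ∑ a, θ a * cu4o8Tau a i j

/-- The `θ`-combined repulsion table of the `Cu₄O₈` block: `Σ_a θ_a · cu4o8Ups a`. [cite: PavariniEtAl2001, eq. (1)] -/
def blockUps (θ : Fin 14 → ℝ) (i : Fin 1 ×ₗ Fin 12) : ℝ := ∑ a, θ a * cu4o8Ups a i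

/-- The `θ`-combined site-energy table of the `Cu₄O₈` block: `Σ_a θ_a · cu4o8Nu a`. [cite: PavariniEtAl2001, eq. (1)] -/
def blockNu (θ : Fin 14 → ℝ) (i : Fin 1 ×ₗ Fin 12) : ℝ := ∑ a, θ a * cu4o8Nu a i

/-- **THE BLOCK DICTIONARY AT `θ`**: relabelled by rank, `H^θ_S = hubbardOpenBoxGP 1 12 (blockTau θ) (blockUps θ) (blockNu θ)`, `S` the twelve physical
sites of the open `Cu₄O₈` block. [cite: PavariniEtAl2001, eq. (1)] -/
theorem relabel_block_emeryInteraction (θ : Fin 14 → ℝ) :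
    relabel (Orb.mapEquiv cu4o8SiteEquiv) ((emeryInteraction θ).localHamiltonian (emeryPhysSites block2x2)) =
      hubbardOpenBoxGP 1 12 (blockTau θ) (blockUps θ) (blockNu θ) := by
  rw [localHamiltonian_emeryInteraction, map_sum]
  simp_rw [map_smul, relabel_block_emeryAtoms]
  unfold blockTau blockUps blockNu
  rw [hubbardOpenBoxGP_eq_generalPairHamiltonian, generalPairHamiltonian_linear]
  simp_rw [hubbardOpenBoxGP_eq_generalPairHamiltonian]

/-- **The block partition function is the general-pair cluster's**: `Z_β(H^θ_S) = Z_β(hubbardOpenBoxGP 1 12 (blockTau θ) (blockUps θ) (blockNu θ))`.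
[cite: PavariniEtAl2001, eq. (1)] -/
theorem partitionFn_block_eq (β : ℝ) (θ : Fin 14 → ℝ) :
    Matrix.partitionFn β ((emeryInteraction θ).localHamiltonian (emeryPhysSites block2x2)) =
      Matrix.partitionFn β (hubbardOpenBoxGP 1 12 (blockTau θ) (blockUps θ) (blockNu θ)) := by
  rw [← relabel_block_emeryInteraction, partitionFn_relabel]

/-- The general-pair block cluster at `θ` is Hermitian (it is a relabelled local Hamiltonian). [cite: PavariniEtAl2001, eq. (1)] -/
theorem hubbardOpenBoxGP_block_isHermitian (θ : Fin 14 → ℝ) : (hubbardOpenBoxGP 1 12 (blockTau θ) (blockUps θ) (blockNu θ)).IsHermitian := by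
  rw [← relabel_block_emeryInteraction]
  exact isHermitian_relabel _ (FermionInteraction.localHamiltonian_isHermitian (emeryInteraction_structure θ).1 _)

/-- `|Cell block2x2| = 4` as a real number. [cite: ArakiMoriya2003, §4.1 Def. 4.3] -/
theorem card_cell_block2x2_real : (Fintype.card (Cell block2x2) : ℝ) = 4 := by
  have h : Fintype.card (Cell block2x2) = 4 := by decide
  rw [h]; norm_num

/-! ### §2. The device floor -/

/-- **THE FLOOR FROM CLUSTER VECTORS, exact-Rayleigh form**: for a nonempty orthonormal family `(φ_i)` of vectors of the cluster Fock space over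
`Fin 1 ×ₗ Fin 12` and every real `β`, `log Σ_i e^{−β Re⟨φ_i, H^G_θ φ_i⟩} ≤ 4 · emeryCellPressure β θ`, `H^G_θ = hubbardOpenBoxGP 1 12 (blockTau θ) …`.
[cite: Ruelle1969, §2.5–2.6] [cite: Israel1979, Lemma II.3.1] -/
theorem log_sum_exp_rayleigh_le_emeryCellPressure (β : ℝ) (θ : Fin 14 → ℝ) {ι : Type*} [Fintype ι] [DecidableEq ι] [Nonempty ι]
    {φ : ι → Fock (Orb (Fin 1 ×ₗ Fin 12))} (hφ : ∀ i j, star (φ i) ⬝ᵥ φ j = if i = j then 1 else 0) :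
    Real.log (∑ i, Real.exp (-(β * (star (φ i) ⬝ᵥ (hubbardOpenBoxGP 1 12 (blockTau θ) (blockUps θ) (blockNu θ) *ᵥ φ i)).re))) ≤
      4 * emeryCellPressure β θ := by
  have h1 := (hubbardOpenBoxGP_block_isHermitian θ).log_sum_exp_neg_mul_rayleigh_le β hφ
  have h2 := log_partitionFn_physCluster_le β θ block2x2
  rw [partitionFn_block_eq, card_cell_block2x2_real] at h2
  exact h1.trans h2

/-- **THE DEVICE FLOOR.** For `β ≥ 0`, a nonempty orthonormal family `(φ_i)` of cluster vectors and certified bounds on their Rayleigh quotients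
`Re⟨φ_i, hubbardOpenBoxGP 1 12 (blockTau θ) (blockUps θ) (blockNu θ) φ_i⟩ ≤ e_i`: **`¼ · log Σ_i e^{−β e_i} ≤ emeryCellPressure β θ`** — a certified
CAP on the three-band free energy per `CuO₂` unit at temperature `1/β`. [cite: Ruelle1969, §2.5–2.6] [cite: Israel1979, Lemma II.3.1] -/
theorem le_emeryCellPressure_of_rayleighFamily {β : ℝ} (hβ : 0 ≤ β) (θ : Fin 14 → ℝ) {ι : Type*} [Fintype ι] [DecidableEq ι] [Nonempty ι]
    {φ : ι → Fock (Orb (Fin 1 ×ₗ Fin 12))} (hφ : ∀ i j, star (φ i) ⬝ᵥ φ j = if i = j then 1 else 0) {e : ι → ℝ}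
    (he : ∀ i, (star (φ i) ⬝ᵥ (hubbardOpenBoxGP 1 12 (blockTau θ) (blockUps θ) (blockNu θ) *ᵥ φ i)).re ≤ e i) :
    Real.log (∑ i, Real.exp (-(β * e i))) / 4 ≤ emeryCellPressure β θ := by
  have hpos : 0 < ∑ i, Real.exp (-(β * e i)) := Finset.sum_pos (fun i _ => Real.exp_pos _) Finset.univ_nonempty
  have hmono : ∑ i, Real.exp (-(β * e i)) ≤
      ∑ i, Real.exp (-(β * (star (φ i) ⬝ᵥ (hubbardOpenBoxGP 1 12 (blockTau θ) (blockUps θ) (blockNu θ) *ᵥ φ i)).re)) :=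
    Finset.sum_le_sum fun i _ => Real.exp_le_exp.2 (by nlinarith [he i])
  have h := (Real.log_le_log hpos hmono).trans (log_sum_exp_rayleigh_le_emeryCellPressure β θ hφ)
  linarith

/-- **ONE VECTOR**: a unit cluster vector with `Re⟨φ, H^G_θ φ⟩ ≤ e` gives `−β e/4 ≤ emeryCellPressure β θ` (`β ≥ 0`) — the trial energy per cell caps
the free energy per cell. [cite: Ruelle1969, §2.5–2.6] -/
theorem neg_mul_le_emeryCellPressure_of_rayleigh {β : ℝ} (hβ : 0 ≤ β) (θ : Fin 14 → ℝ) {φ : Fock (Orb (Fin 1 ×ₗ Fin 12))}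
    (hφ : star φ ⬝ᵥ φ = 1) {e : ℝ} (he : (star φ ⬝ᵥ (hubbardOpenBoxGP 1 12 (blockTau θ) (blockUps θ) (blockNu θ) *ᵥ φ)).re ≤ e) :
    -(β * e) / 4 ≤ emeryCellPressure β θ := by
  have h := le_emeryCellPressure_of_rayleighFamily hβ θ (ι := Unit) (φ := fun _ => φ) (fun _ _ => by rw [if_pos rfl, hφ]) (e := fun _ => e)
    (fun _ => he)
  simpa using h

end Literature.MathematicalPhysics.QuantumLattice

end
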